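import Literature.NumberTheory.DiophantineGeometry.Bcgp2025ModThreeSurjectiveModular
import Literature.NumberTheory.GaloisRepresentations.GSp4Reasonable
import Literature.AlgebraicGeometry.Motives.AbelianVarietyBaseChange
import HarnessLib

/-!
# Boxer–Calegari–Gee–Pilloni 2025, Theorem 9.5.2: abelian surfaces over `ℚ` whose mod-`3` image
# is one of the 15 subgroups of Table 6.4.4 (with `End(A_ℚ̄) = ℤ`, a condition at `2`, good
# ordinary and `3`-distinguished at `3`) are modular

Topic `Literature/NumberTheory/DiophantineGeometry`, sibling of
`Bcgp2025ModThreeSurjectiveModular.lean` (Theorem A = the case `im ρ̄_{A,3} = GSp₄(𝔽₃)`), whose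
clause shapes (2), (3a), (3b) and conclusion it repeats VERBATIM.  ONE named fact (D-0014), no
proof, no new definition: Theorem 9.5.2 (the second Theorem of §9.5; TeX label `firstlater`;
chunk p0136 L95–117 of the held arXiv TeX rendering `paper:arxiv-2502.20645` — a chunk id, not a
PDF page; numbering verified against the arXiv v1 source counters by the cell's second literature
seat, `lit/LIT2-RESIDUAL-MODULARITY.md` §8) of G. Boxer, F. Calegari, T. Gee, V. Pilloni,
*Modularity theorems for abelian surfaces*, arXiv:2502.20645 (2025), in its GENERAL form: the
mod-`3` image may be any of the 15 "ticked" conjugacy classes of subgroups of `GSp₄(𝔽₃)` of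
Lemma 6.4.3 / Table 6.4.4.  This is the consumer theorem of the "small image" flag (T-S) of the
venture cell `pub-residmod` (`run/shared/lean/pub/pub-residmod/lit/BCGP-AS-PRINTED.md`, §B2–B3;
PLAN §4 row T-S); hypothesis (1) is rendered through the printed Lemma 6.4.3, which needs
Whitmore's "`GSp₄`-reasonable" (`GSp4Reasonable.lean`).

## The printed statements

**Theorem 9.5.2**, verbatim: "Let `A/ℚ` be an abelian surface with a polarization of degree prime
to `3`. Suppose that the following conditions hold: (1) The image of the mod `3` representation
`ρ̄_{A,3} : Gal(ℚ̄/ℚ) → GSp₄(𝔽₃)` is one of the `15` subgroups listed in Lemma [6.4.3], and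
`End(A_ℚ̄) = ℤ`. (2) `ρ̄_{A,3}|_{G_{ℚ₂}}` is unramified, and the image of `ρ̄_{A,3}(Frob₂)` inside
`PGSp₄(𝔽₃) ∖ PSp₄(𝔽₃)` does not have conjugacy class `4C` or `12C` (see Lemma [9.1.3]).
Equivalently, the characteristic polynomial of `ρ̄_{A,3}(Frob₂)` is not `(x² ± x + 2)²`. (3) `A`
has good ordinary reduction at `3` and is `3`-distinguished. Then `A` is modular. More precisely,
there exists a cuspidal automorphic representation `π` for `GL₄/ℚ` (the transfer of a cuspidal
automorphic representation of `GSp₄/ℚ` of weight `2`) such that `L(s, H¹(A)) = L(s, π)`."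

**Lemma 6.4.3** (label `listofsubgroups`; chunk p0102 L84 – p0103 L38), verbatim: "Let `A/ℚ` be an
abelian surface with a prime to `3` polarization and good reduction at `3`, and let
`ρ̄ = ρ̄_{A,3} : G_ℚ → GSp₄(𝔽₃)` denote the corresponding mod `3` representation. Then the following
hypotheses: (1) `ρ̄` is `GSp₄`-reasonable in the sense of [Whitmore, Defn. 3.19], (2) `ρ̄` is tidy in
the sense of [BCGP, Defn. 7.5.11], (3) `ρ̄(G_{ℚ(ζ₃)})` contains a regular semi-simple element, (4)
`ρ̄(G_ℚ) ∖ ρ̄(G_{ℚ(ζ₃)})` contains a regular semi-simple element, are satisfied precisely if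
`Γ′ = ρ̄(G_ℚ)` in Table [6.4.4] has a tick, where otherwise the cross indicates the corresponding
obstruction to condition (1), (2), (3), or (4). In particular, these conditions are all satisfied if
`ρ̄(G_ℚ) = GSp₄(𝔽₃)`."  **Table 6.4.4** (label `tabletwo`; arXiv v1 e-print source, transcribed
in the cell's `lit/BCGP25-Lemma6.4.3-Table6.4.4-source.tex`), caption verbatim: "Conjugacy classes
of subgroups `Γ′ ⊂ GSp₄(𝔽₃)` with `ν(Γ′) ≠ 1` and `Γ = Γ′ ∩ Sp₄(𝔽₃)` absolutely irreducible.
LMFDB labels determine the conjugacy class of `Γ′`, the small group labels [MR1826989] determine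
`Γ`, `Γ′` up to abstract isomorphism."  It has 25 rows (LMFDB labels 3.1620.1, 3.1620.2, 3.1620.5,
3.1620.10, 3.1296.1, 3.810.1, 3.810.2, 3.810.5, 3.810.6, 3.540.1, 3.540.2, 3.540.3, 3.540.5,
3.540.7, 3.405.1, 3.270.1, 3.216.1, 3.216.2, 3.162.1, 3.135.1, 3.135.2, 3.45.1, 3.36.1, 3.27.1,
1.1.1), of which exactly 15 carry a tick: **3.1620.1, 3.1620.5, 3.1620.10, 3.1296.1, 3.810.2,
3.810.6, 3.540.1, 3.405.1, 3.270.1, 3.216.1, 3.135.1, 3.135.2, 3.45.1, 3.27.1, 1.1.1** — "the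
15 subgroups listed in Lemma 6.4.3".  (The count 25 of conjugacy classes `Γ′ ≤ GSp₄(𝔽₃)` with
`ν(Γ′) ≠ 1` and `Γ′ ∩ Sp₄(𝔽₃)` absolutely irreducible is printed independently in Whitmore's
Table 5, arXiv:2205.05062v4 p. 85, and §4.3 p. 39: "only 12 of the possible 25 choices of `Γ′`";
both are Magma computations.)

How Theorem 9.5.2 is proved (chunks p0136 L119 – p0137 L27): Lemma 9.4.2 (2) (tree:
`bcgp_switchingSurface_exists`) and the `2`-adic Theorem 8.3.2 (tree:
`bcgp_residuallyA5b_modular_abelianSurface`) produce a modular genus-2 Jacobian `B` with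
`ρ̄_{B,3} ≅ ρ̄_{A,3}`; then Theorem 9.5.1 (the `p > 2` congruence-lifting theorem) at `p = 3`, whose
condition (4) "follows from `End(A_ℚ̄) = ℤ` by [MR1730973]" and whose conditions (5)–(8)
(`GSp₄`-reasonable, tidy, the two regular-semisimple conditions) "hold by Lemma [6.4.3] and our
assumptions on `A`".

## Rendering (clause by clause; the reading reviewers should attack)

HYPOTHESES on `A : AbelianVariety ℚ`, `A.dim = 2`, a torsion frame `(ρ₀, e)` of `A[3](ℚ̄)` and
`ρb = ρ₀^∨ = FramedRep.dual ρ₀` (the representation on `H¹(A_ℚ̄, 𝔽₃)`, the paper's `ρ̄_{A,3}`),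
exactly as in the sibling:
* (0) "a polarization of degree prime to `3`" — by what the source uses it for (§1.8.23: it makes
  `ρ̄_{A,3}` a `GSp₄`-valued representation of multiplier `ε̄⁻¹`): an invertible alternating
  `J ∈ M₄(𝔽₃)` with `ρb(σ)ᵀ J ρb(σ) = ε̄(σ)⁻¹ J` for all `σ` (VERBATIM the first conjunct of the
  sibling's (0)+(1)); the big-image clauses below refer to this `J`.
* (1) "the image … is one of the 15 subgroups listed in Lemma 6.4.3, and `End(A_ℚ̄) = ℤ`" is
  rendered BY THE PRINTED LEMMA, as the conjunction of: the Table 6.4.4 caption condition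
  "`Γ = Γ′ ∩ Sp₄(𝔽₃)` absolutely irreducible" with `Γ = ρ̄(G_{ℚ(ζ₃)})` (for multiplier `ε̄⁻¹` and
  `J` invertible, `ρ̄(σ) ∈ Sp(J) ⟺ ε̄(σ) = 1 ⟺ σ ∈ G_{ℚ(ζ₃)}`; tree `IsAbsIrreducible` of the
  subgroup `ρb.imageOn (galCyclotomicPow ℚ 3 1)`); the caption condition `ν(Γ′) ≠ 1` is implied by
  (L2) (a tidy subgroup contains an element of multiplier `≠ 1`) and is not repeated; Lemma 6.4.3
  (1) `ρb.IsGSp4Reasonable J 3` (Whitmore Def. 3.19, `GSp4Reasonable.lean`); (2) `ρb.IsTidy J`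
  (BCGP 2021 Def. 7.5.11, `GSp4BigImage.lean`); (3) some element of `ρ̄(G_{ℚ(ζ₃)})` is regular
  semisimple (separable characteristic polynomial, tree `IsRegularSemisimple`, as in (E3) of
  `GSp4BigImage.lean` and in Lemma 6.4.1's count); (4) some element of `ρ̄(G_ℚ) ∖ ρ̄(G_{ℚ(ζ₃)})` is
  regular semisimple; AND "`End(A_ℚ̄) = ℤ`" literally: every endomorphism of the base change
  `A_ℚ̄ = A.baseChange (AlgebraicClosure ℚ)` is `n · 𝟙`, `n ∈ ℤ` (the shape of the tree's
  `bcgp_switch_endClause_of_geomEnd`).  WHY THIS IS THE PRINTED HYPOTHESIS, neither weaker nor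
  stronger: under (0) and (3a) (good reduction at `3`) the printed Lemma 6.4.3 says that its
  conditions (1)–(4) hold "precisely if `Γ′ = ρ̄(G_ℚ)` in Table 6.4.4 has a tick", and Table 6.4.4 is
  the list of ALL conjugacy classes of subgroups `Γ′` with `ν(Γ′) ≠ 1` and `Γ′ ∩ Sp₄(𝔽₃)`
  absolutely irreducible (caption; 25 classes, the same count as Whitmore's Table 5); so
  [caption conditions ∧ (1)–(4)] singles out exactly the 15 ticked classes.  This is also the form
  in which the printed PROOF consumes hypothesis (1) (conditions (5)–(8) of Theorem 9.5.1).
  Explicit generators of the 15 classes are deliberately not vendored: the printed identification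
  is by LMFDB label and abstract isomorphism type, which a reviewer cannot check against a list of
  matrices, whereas each clause here is a printed definition.
* (2), (3a), (3b): VERBATIM the sibling's — unramified at `v ∣ 2` with every Frobenius
  characteristic polynomial `≠ (X² ± X + 2)²` (the theorem's own "Equivalently" form);
  `A.HasGoodOrdinaryReductionAt v` for `v ∣ 3`; for every `ℓ ≠ 3` every framed dual of `V_ℓ(A)` is
  unramified at `v ∣ 3` with separable Frobenius characteristic polynomial — "`A` … is
  `3`-distinguished" read through Definition 9.1.2, verbatim: "if `B` has good ordinary reduction,
  then `B` is `p`-distinguished if and only if the characteristic polynomial `Q(x)` of `Frob_p` on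
  `T_ℓ B`, `ℓ ≠ p`, has pairwise distinct roots" (the tree's bridge for this sentence is the named
  fact `bcgp2025_goodOrdinary_pDistinguished_abelianSurface`).
* CONCLUSION: VERBATIM the sibling's `GL₄` almost-everywhere clause (for every `p`, every framed
  dual `r` of `V_p(A)`, every `ι : ℚ̄_p ≃ ℂ`, an L-algebraic cuspidal `π` on `GL₄(𝔸_ℚ)` whose Satake
  parameters give `det(X − r(Frob_v))` for almost all `v`).

What is deliberately NOT here: Theorem 9.5.1 itself (its hypothesis (3) "a weight 2 cuspidal
automorphic representation `π` for `GSp₄/ℚ` of level prime to `p`, ordinary at `p`, with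
`ρ_{π,p} ≅ ρ_{B,p}`" has no faithful rendering without `GSp₄` automorphic vocabulary, which the
tree lacks — the same restriction as all siblings); the curve forms Theorems 9.5.3 / 9.5.4 /
Theorem B (no Jacobians in the tree); the bad-reduction-at-`2` variant Theorem 9.5.5 in the
15-subgroup generality (its surjective case is `bcgp2025_modThreeSurjective_badAtTwo_modular_abelianSurface`);
a derivation of Theorem A's fact from this one (it would need the finite-group facts "GSp₄(𝔽₃) is
reasonable, tidy and has the two regular semisimple elements" — Lemma 6.4.3's last sentence, a Magma
computation — and "surjective ⟹ `End(A_ℚ̄) = ℤ`", §9.5 ¶1).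

## Status

CONDITIONAL IN PRINT on the twisted weighted fundamental lemma (§1.6, quoted in the sibling's
module docstring); Lemma 6.4.3 / Table 6.4.4 and Lemma 9.1.3 are Magma computations (Remark
9.1.5).  Users take `(h : bcgp2025_modThreeListedImage_modular_abelianSurface)`; a discharge would
have to formalise §§2–9 of the source and Arthur's transfer (SIZE XL).

## References

* [BoxerCalegariGeePilloni2025] G. Boxer, F. Calegari, T. Gee, V. Pilloni, *Modularity theorems
  for abelian surfaces*, arXiv:2502.20645 (2025): Theorem 9.5.2 (label `firstlater`) and its proof,
  Lemma 6.4.3 / Table 6.4.4 (labels `listofsubgroups`, `tabletwo`), Lemma 6.4.1, Lemma 6.4.2,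
  Theorem 9.5.1, §1.8.23, §1.8.24 Definition 1.8.25 (modular), Definition 9.1.2, Lemma 9.1.3,
  §1.6 (conditionality), §10.1 ("three additional curves").
* [Whitmore2022] D. Whitmore, *The Taylor–Wiles method for reductive groups*, arXiv:2205.05062:
  Def. 3.19 (`Ĝ`-reasonable), §4.3 and Table 5 (the 25 classes).
* [BoxerEtAl2021] G. Boxer, F. Calegari, T. Gee, V. Pilloni, Publ. Math. IHÉS 134 (2021):
  Def. 7.5.11 (tidy), §2.1 (`GSp₄`).
-/

namespace Literature.NumberTheory.DiophantineGeometry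

open CategoryTheory IsDedekindDomain
open scoped NumberField Matrix
open Literature.NumberTheory.GaloisRepresentations Literature.NumberTheory.Automorphic
open Literature.AlgebraicGeometry.Motives (AbelianVariety)

/-- **Boxer–Calegari–Gee–Pilloni 2025, Theorem 9.5.2** (arXiv:2502.20645, label `firstlater`;
`GL₄` almost-everywhere form; the 15-subgroup generalisation of Theorem A). Every abelian surface
`A/ℚ` (`AbelianVariety ℚ`, `dim A = 2`) such that, for a torsion frame `(ρ₀, e)` of `A[3](ℚ̄)` and
`ρb = ρ₀^∨` (the paper's `ρ̄_{A,3}` on `H¹(A_ℚ̄, 𝔽₃)`):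
(0) `ρb` is symplectic with multiplier `ε̄⁻¹` for an invertible alternating `J` ("a polarization of
degree prime to `3`", §1.8.23), AND (1) "the image of `ρ̄_{A,3}` is one of the 15 subgroups listed
in Lemma 6.4.3" — rendered by that Lemma and the caption of Table 6.4.4 as: `ρ̄(G_{ℚ(ζ₃)}) =
Γ′ ∩ Sp₄(𝔽₃)` is absolutely irreducible, `ρ̄` is `GSp₄`-reasonable [Whitmore, Def. 3.19]
(`IsGSp4Reasonable`), tidy [BCGP 2021, Def. 7.5.11] (`IsTidy`), `ρ̄(G_{ℚ(ζ₃)})` contains a regular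
semisimple element and so does `ρ̄(G_ℚ) ∖ ρ̄(G_{ℚ(ζ₃)})` ("satisfied precisely if `Γ′` in Table
6.4.4 has a tick") — "and `End(A_ℚ̄) = ℤ`" (every endomorphism of `A_ℚ̄` is `n · 𝟙`);
(2) `ρb` is unramified at `2` with Frobenius characteristic polynomial `≠ (X² ± X + 2)²`;
(3) `A` has good ordinary reduction at `3` and, for every `ℓ ≠ 3`, the framed dual of `V_ℓ(A)` is
unramified at `3` with separable Frobenius characteristic polynomial there ("`3`-distinguished",
Definition 9.1.2) — is MODULAR: for every prime `p`, every framed dual `r` of `V_p(A)` and every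
`ι : ℚ̄_p ≃ ℂ` there is an L-algebraic cuspidal automorphic representation of `GL₄(𝔸_ℚ)` whose
Satake parameters give `det(X − r(Frob_v))` at all but finitely many `v` (VERBATIM the conclusion
clause of `bcgp2025_modThreeSurjective_modular_abelianSurface`).  Conditional in print on the twisted
weighted fundamental lemma (§1.6).  Users take
`(h : bcgp2025_modThreeListedImage_modular_abelianSurface)`.  Named fact (D-0014), not proved in
the tree.
[cite: BoxerCalegariGeePilloni2025, Theorem 9.5.2 (label `firstlater`) and its proof; Lemma 6.4.3 with Table 6.4.4 (the 15 ticked classes 3.1620.1, 3.1620.5, 3.1620.10, 3.1296.1, 3.810.2, 3.810.6, 3.540.1, 3.405.1, 3.270.1, 3.216.1, 3.135.1, 3.135.2, 3.45.1, 3.27.1, 1.1.1); §1.8.23; Definition 9.1.2; §1.6]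
[cite: Whitmore2022, Def. 3.19 (GSp₄-reasonable)] -/
def bcgp2025_modThreeListedImage_modular_abelianSurface : Prop :=
  ∀ (A : AbelianVariety ℚ), A.dim = 2 →
    ∀ (ρ₀ : FramedGaloisRep ℚ (ZMod 3) 4) (e : A.geomTorsion (3 : ℕ) ≃+ (Fin 4 → ZMod 3))
      (ρb : FramedGaloisRep ℚ (ZMod 3) 4),
      (∀ (σ : Field.absoluteGaloisGroup ℚ) (P : A.geomTorsion (3 : ℕ)),
        e (σ • P) = ((ρ₀ σ : GL (Fin 4) (ZMod 3)) : Matrix (Fin 4) (Fin 4) (ZMod 3)) *ᵥ e P) →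
      FramedRep.dual ρ₀ = ρb →
    -- (0) `ρ̄_{A,3}` is `GSp₄`-valued with multiplier `ε̄⁻¹` for the form `J`, and
    -- (1), Lemma 6.4.3 (1), (2): `ρ̄_{A,3}` is `GSp₄`-reasonable [Whitmore 3.19] and tidy for `J`
    (∃ J : Matrix (Fin 4) (Fin 4) (ZMod 3), Jᵀ = -J ∧ IsUnit J.det ∧
      (∀ σ : Field.absoluteGaloisGroup ℚ,
        (ρb σ).valᵀ * J * (ρb σ).val =
          (((modPCyclotomicCharacterZMod ℚ 3 σ)⁻¹ : (ZMod 3)ˣ) : ZMod 3) • J) ∧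
      ρb.IsGSp4Reasonable J 3 ∧ ρb.IsTidy J) →
    -- (1), Table 6.4.4 caption: `Γ = ρ̄(G_{ℚ(ζ₃)}) = Γ′ ∩ Sp₄(𝔽₃)` is absolutely irreducible
    IsAbsIrreducible (ρb.imageOn (galCyclotomicPow ℚ 3 1)).subtype →
    -- (1), Lemma 6.4.3 (3): `ρ̄(G_{ℚ(ζ₃)})` contains a regular semisimple element
    (∃ g ∈ ρb.imageOn (galCyclotomicPow ℚ 3 1), IsRegularSemisimple g) →
    -- (1), Lemma 6.4.3 (4): `ρ̄(G_ℚ) ∖ ρ̄(G_{ℚ(ζ₃)})` contains a regular semisimple element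
    (∃ g ∈ ρb.imageOn ⊤, g ∉ ρb.imageOn (galCyclotomicPow ℚ 3 1) ∧ IsRegularSemisimple g) →
    -- (1): `End(A_ℚ̄) = ℤ`
    (∀ f : A.baseChange (AlgebraicClosure ℚ) ⟶ A.baseChange (AlgebraicClosure ℚ),
      ∃ n : ℤ, f = n • 𝟙 (A.baseChange (AlgebraicClosure ℚ))) →
    -- (2): unramified at `2`, `charpoly ρ̄_{A,3}(Frob₂) ≠ (X² ± X + 2)²`
    (∀ v : HeightOneSpectrum (𝓞 ℚ), ((2 : ℕ) : 𝓞 ℚ) ∈ v.asIdeal →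
      ρb.IsUnramifiedAt v ∧
        ∀ Q : Polynomial (ZMod 3), ρb.HasFrobCharpolyAt v Q →
          Q ≠ (Polynomial.X ^ 2 + Polynomial.X + 2) ^ 2 ∧
            Q ≠ (Polynomial.X ^ 2 - Polynomial.X + 2) ^ 2) →
    -- (3a): good ordinary reduction at `3`
    (∀ v : HeightOneSpectrum (𝓞 ℚ), ((3 : ℕ) : 𝓞 ℚ) ∈ v.asIdeal →
      A.HasGoodOrdinaryReductionAt v) →
    -- (3b): `3`-distinguished — the Frobenius polynomial at `3` on `T_ℓ A`, `ℓ ≠ 3`, is separable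
    (∀ (ℓ : ℕ) [Fact ℓ.Prime], ℓ ≠ 3 →
      ∀ (b : Module.Basis (Fin 4) ℚ_[ℓ] (A.rationalTateModule ℓ))
        (r : FramedGaloisRep ℚ (PadicAlgCl ℓ) 4),
        (∀ g : Field.absoluteGaloisGroup ℚ,
          (r g).val =
            ((LinearMap.toMatrix b b (A.rationalTateRep ℓ g⁻¹)).map
              (algebraMap ℚ_[ℓ] (PadicAlgCl ℓ))).transpose) →
        ∀ v : HeightOneSpectrum (𝓞 ℚ), ((3 : ℕ) : 𝓞 ℚ) ∈ v.asIdeal →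
          r.IsUnramifiedAt v ∧
            ∀ Q : Polynomial (PadicAlgCl ℓ), r.HasFrobCharpolyAt v Q → Q.Separable) →
    -- conclusion: `A` is modular (`GL₄` almost-everywhere form)
    ∀ (p : ℕ) [Fact p.Prime] (b : Module.Basis (Fin 4) ℚ_[p] (A.rationalTateModule p))
      (r : FramedGaloisRep ℚ (PadicAlgCl p) 4),
      (∀ g : Field.absoluteGaloisGroup ℚ,
        (r g).val =
          ((LinearMap.toMatrix b b (A.rationalTateRep p g⁻¹)).map
            (algebraMap ℚ_[p] (PadicAlgCl p))).transpose) →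
      ∀ (hcpt : isCompact_glFiniteIntegralLevel 4 ℚ) (ι : PadicAlgCl p ≃+* ℂ),
        ∃ π : CuspidalAutomorphicRepData 4 ℚ hcpt, π.1.IsLAlgebraic ∧
          ∀ᶠ v : HeightOneSpectrum (𝓞 ℚ) in Filter.cofinite, ∃ a : Multiset ℂ,
            π.1.HasSatakeParamAt v a ∧ r.IsUnramifiedAt v ∧
              r.HasFrobCharpolyAt v (arithFrobPolyOfSatake ι v.residueCard 1 a)

/-- **Theorem A is the surjective case of Theorem 9.5.2, at the level of the tree's facts**: the
general fact implies the sibling fact `bcgp2025_modThreeSurjective_modular_abelianSurface` as soon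
as one grants the two printed finite/structural inputs for a SURJECTIVE `ρ̄_{A,3}` — (i) Lemma
6.4.3's last sentence ("these conditions are all satisfied if `ρ̄(G_ℚ) = GSp₄(𝔽₃)`") together
with the caption condition, i.e. the four image clauses of hypothesis (1), and (ii) "if `ρ̄_{A,3}`
is surjective, then `End(A_ℚ̄) = ℤ` is automatic" (§9.5 ¶1) — both supplied here as hypotheses
on surjective frames (`himg`, `hEnd`), so this is bookkeeping, not a discharge of those inputs.
[cite: BoxerCalegariGeePilloni2025, Lemma 6.4.3 (last sentence) and §9.5 ¶1 ("Theorem 9.5.2 really does imply Theorem A")] -/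
theorem bcgp2025_modThreeSurjective_of_modThreeListedImage
    (h : bcgp2025_modThreeListedImage_modular_abelianSurface)
    (himg : ∀ (ρb : FramedGaloisRep ℚ (ZMod 3) 4) (J : Matrix (Fin 4) (Fin 4) (ZMod 3)),
      Jᵀ = -J → IsUnit J.det →
      (∀ σ : Field.absoluteGaloisGroup ℚ,
        (ρb σ).valᵀ * J * (ρb σ).val =
          (((modPCyclotomicCharacterZMod ℚ 3 σ)⁻¹ : (ZMod 3)ˣ) : ZMod 3) • J) →
      (∀ M : Matrix (Fin 4) (Fin 4) (ZMod 3),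
        (∃ c : (ZMod 3)ˣ, Mᵀ * J * M = (c : ZMod 3) • J) →
          ∃ σ : Field.absoluteGaloisGroup ℚ, (ρb σ).val = M) →
      ρb.IsGSp4Reasonable J 3 ∧ ρb.IsTidy J ∧
        IsAbsIrreducible (ρb.imageOn (galCyclotomicPow ℚ 3 1)).subtype ∧
        (∃ g ∈ ρb.imageOn (galCyclotomicPow ℚ 3 1), IsRegularSemisimple g) ∧
        (∃ g ∈ ρb.imageOn ⊤, g ∉ ρb.imageOn (galCyclotomicPow ℚ 3 1) ∧ IsRegularSemisimple g))
    (hEnd : ∀ (A : AbelianVariety ℚ), A.dim = 2 →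
      ∀ (ρ₀ : FramedGaloisRep ℚ (ZMod 3) 4) (e : A.geomTorsion (3 : ℕ) ≃+ (Fin 4 → ZMod 3)),
        (∀ (σ : Field.absoluteGaloisGroup ℚ) (P : A.geomTorsion (3 : ℕ)),
          e (σ • P) = ((ρ₀ σ : GL (Fin 4) (ZMod 3)) : Matrix (Fin 4) (Fin 4) (ZMod 3)) *ᵥ e P) →
        (∃ J : Matrix (Fin 4) (Fin 4) (ZMod 3), Jᵀ = -J ∧ IsUnit J.det ∧
          ∀ M : Matrix (Fin 4) (Fin 4) (ZMod 3),
            (∃ c : (ZMod 3)ˣ, Mᵀ * J * M = (c : ZMod 3) • J) →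
              ∃ σ : Field.absoluteGaloisGroup ℚ, (FramedRep.dual ρ₀ σ).val = M) →
        ∀ f : A.baseChange (AlgebraicClosure ℚ) ⟶ A.baseChange (AlgebraicClosure ℚ),
          ∃ n : ℤ, f = n • 𝟙 (A.baseChange (AlgebraicClosure ℚ))) :
    bcgp2025_modThreeSurjective_modular_abelianSurface := by
  intro A hA ρ₀ e ρb he hdual hJ h2 h3a h3b
  obtain ⟨J, hJalt, hJdet, hsymp, hsurj⟩ := hJ
  obtain ⟨hreas, htidy, hirr, hrss, hrss'⟩ := himg ρb J hJalt hJdet hsymp hsurj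
  refine h A hA ρ₀ e ρb he hdual ⟨J, hJalt, hJdet, hsymp, hreas, htidy⟩ hirr hrss hrss' ?_ h2 h3a h3b
  refine hEnd A hA ρ₀ e he ⟨J, hJalt, hJdet, fun M hM => ?_⟩
  rw [hdual]
  exact hsurj M hM

end Literature.NumberTheory.DiophantineGeometry
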